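import Summits.CriticalPhenomena.Ising3D.Control2DFourPoint
import Summits.CriticalPhenomena.Ising3D.Control2DParityRecord
import Mathlib.Tactic.Linarith
import Mathlib.Tactic.NormNum
import Mathlib.Tactic.FieldSimp
import Mathlib.Tactic.Ring
import HarnessLib

/-!
# Parity symmetry is bookkeeping — the converse without a convergence hypothesis; the record as a four-point function
(cell `pub-ising3x`, seat controls-1 gen 42; PAPER §6.2 / Appendix E — CONTROL-ONLY; part 2 of 2, part 1 is
`Control2DFourPoint`)

HONEST FRAMING: lottery ticket; floor = tightest certified 3D Ising CFT bounds; no exact-solution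
claim without a proof. CONTROL-ONLY (`d = 2`, `Δ_σ = s` an INPUT, axiom set `A2D′`); nothing here is about `d = 3`,
no certificate, functional or number of the record is touched, and no new hypothesis or named fact enters.

`Control2DParity` / `Control2DParityRecord` (gen 41) proved that ORIENTED data (independent left/right weights)
symmetrise into the typed class (`symm`), so every typed statement transfers, and that the converse reading
`CrossingData.double` solves the oriented sum rule GIVEN convergence of `Σ p g` on the open square — with the remark
«the typed sum rule alone does not supply it». This file shows that for `s < 1` it DOES:

* `orientedBlock_scalar`, `crossF_orientedBlock_scalar`: a SCALAR label needs no splitting — both orientations of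
  `(Δ, 0)` are `k_{Δ/2}(z) k_{Δ/2}(z̄) = ½ g_{Δ,0}`, so its oriented sum-rule terms are half the typed ones;
* `CrossingData.summable_oriented`: for EVERY unitary typed solution at `s < 1` and either orientation, the family
  `p_i F_-[b_{i,o}](z,z̄)` is summable at every point of the square — scalars by the previous item, spinning labels
  (`Δ ≥ ℓ ≥ 2 > 2s`) because their expansion converges absolutely on the whole square by the typed sum rule alone
  (`opeConvergent_spinning` of part 1) and `|F_-[b]| ≤ v^s g(z,z̄) + u^s g(1-z,1-z̄)` (`summable_oriented_of_convergent`);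
* **`double_satisfiesCrossing_of_lt_one`**: the doubling of every unitary typed solution solves the ORIENTED sum rule
  (`s < 1`) — NO convergence hypothesis; `double_stressCoeff_eq`, `double_boxCoeff_eq`: the oriented totals of the
  doubling are twice the typed totals UNCONDITIONALLY (both sides are `0` when the indicator family is not summable);
* hence the transfer of gen 41 is an EQUIVALENCE of statement classes for every kind of the record (`s < 1`):
  **`gapExcluded_iff_oriented`, `excludedAt_iff_oriented`, `boxExcluded_iff_oriented`, `twoSided_iff_oriented`,
  `cTwoSided_iff_oriented`, `pBoxTwoSided_iff_oriented`, `controlDataSet_iff_oriented`** — each typed statement holds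
  iff the same statement holds over parity-UNCONSTRAINED data (with the oriented Ward reading `p_T + p_T̄ =
  s²/(2c_L) + s²/(2c_R)`, conclusion on the harmonic mean, and the oriented in-box total `= 2 p_box = λ²`);
* the record as a correlator (part 1 instantiated at `Δ_σ = 1/8`): **`record_fourPoint_crossing (w)`** — every typed
  `A2D′` datum of the record's class (scalars `{x} ∪ [2,∞)`, spin 2 `{2} ∪ [3,∞)`, `w ≤ x`) has its `s`-channel
  expansion absolutely convergent on the open square and `v^{1/8} G(z,z̄) = u^{1/8} G(1-z,1-z̄)` there, because the
  record itself puts `x > 0.99 > 1/4 = 2Δ_σ` (`twoSided_2d_kernel099`); the witnesses of E.1c/E.1e are OPE-convergent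
  in the new sense (`gffData2D_opeConvergent`, `isingData2D_opeConvergent`).

NOT claimed: OPE convergence of typed data with a scalar location `x₀ ≤ 2s` (the doubling theorem does not need it
and does not give it); anything about Virasoro symmetry; `c_L = c_R`; anything three-dimensional; any new bound.

References: R. Rattazzi, V. S. Rychkov, E. Tonni, A. Vichi, JHEP 12 (2008) 031, §3 eq. (3.3)–(3.6), §5
[cite: RattazziEtAl2008, §3]; A. A. Belavin, A. M. Polyakov, A. B. Zamolodchikov, Nucl. Phys. B 241 (1984) 333, §3
[cite: BelavinPolyakovZamolodchikov1984, §3]. Tree: `orientedBlock`, `OrientedData`, `symm`, the `.oriented`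
transfers, `harmonicMean_ward` (`Control2DParity`); `CrossingData.double`, `double_isUnitary`, `double_clauses`,
`summable_oriented_of_convergent` (`Control2DParityRecord`); `OpeConvergent`, `opeConvergent_spinning`,
`opeConvergent_of_location`, `fourPoint`, `fourPoint_crossing` (`Control2DFourPoint`); `twoSided_2d_kernel099`
(`Control2DRecord` closure); `hasSum_gffData2D_blocks` (`Control2DNonVacuity`), `hasSum_isingData2D_blocks`
(`Control2DIsingData`). Mathlib: `summable_subtype_and_compl`, `Summable.comp_injective`,
`tsum_eq_zero_of_not_summable`, `HasSum.sum`, `HasSum.unique`.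
-/

namespace Summit.CriticalPhenomena.Ising3D.Control2D

open Set
open Literature.MathematicalPhysics.QuantumFieldTheory.ConformalBootstrap3D

/-! ### Scalar labels need no splitting -/

/-- **Both orientations of a scalar label are half the typed block**: `b_o(z,z̄) = k_{Δ/2}(z) k_{Δ/2}(z̄) = ½ g_{Δ,0}(z,z̄)`
(`h = h̄ = Δ/2`). [cite: DolanOsborn2004, §3] -/
theorem orientedBlock_scalar (Δ : ℝ) (o : Bool) (z zb : ℝ) :
    orientedBlock Δ 0 o z zb = (1 / 2 : ℝ) * globalBlock Δ 0 z zb := by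
  cases o <;> simp only [orientedBlock, globalBlock, Nat.cast_zero, add_zero, sub_zero] <;> ring

/-- The oriented sum-rule term of a scalar label is half the typed term. [folklore] -/
theorem crossF_orientedBlock_scalar (s σ Δ : ℝ) (o : Bool) (z zb : ℝ) :
    crossF s σ (orientedBlock Δ 0 o) z zb = (1 / 2 : ℝ) * crossF s σ (globalBlock Δ 0) z zb := by
  simp only [crossF, orientedBlock_scalar]
  ring

namespace CrossingData

variable {D : CrossingData} {s : ℝ}

/-! ### Each orientation of a typed solution is summable — no convergence hypothesis -/

/-- **Each orientation of the typed family is summable at every point of the square**, for EVERY unitary solution of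
the typed sum rule at `s < 1` and either orientation `o`: on the spinning labels (`Δ ≥ ℓ ≥ 2 > 2s`) the expansion
converges absolutely on the whole square by the typed sum rule alone (`opeConvergent_spinning`), so
`summable_oriented_of_convergent` applies to that sub-datum; on the scalar labels the oriented term is half the typed
term (`crossF_orientedBlock_scalar`), a sub-family of the summable typed family. [cite: RattazziEtAl2008, §3 eq. (3.6)] -/
theorem summable_oriented (hU : D.IsUnitary) (hC : D.SatisfiesCrossing s) (hs1 : s < 1) (o : Bool) {z zb : ℝ}
    (hz : z ∈ Ioo (0 : ℝ) 1) (hzb : zb ∈ Ioo (0 : ℝ) 1) :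
    Summable fun i => D.p i * crossF s (-1) (orientedBlock (D.Δ i) (D.spin i) o) z zb := by
  have hz' : 1 - z ∈ Ioo (0 : ℝ) 1 := ⟨by linarith [hz.2], by linarith [hz.1]⟩
  have hzb' : 1 - zb ∈ Ioo (0 : ℝ) 1 := ⟨by linarith [hzb.2], by linarith [hzb.1]⟩
  refine (summable_subtype_and_compl
    (f := fun i => D.p i * crossF s (-1) (orientedBlock (D.Δ i) (D.spin i) o) z zb)
    (s := ({i : D.ι | D.spin i ≠ 0} : Set D.ι))).mp ⟨?_, ?_⟩
  · -- spinning labels: the sub-datum on `{ℓ ≠ 0}` has convergent expansion on the square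
    let D' : CrossingData := ⟨↥({i : D.ι | D.spin i ≠ 0} : Set D.ι), fun i => D.Δ i, fun i => D.spin i,
      fun i => D.p i⟩
    have hU' : D'.IsUnitary := fun i => hU i.1
    have h₁ : Summable (fun i : D'.ι => D'.p i * globalBlock (D'.Δ i) (D'.spin i) z zb) :=
      opeConvergent_spinning hU hC hs1 hz hzb
    have h₂ : Summable (fun i : D'.ι => D'.p i * globalBlock (D'.Δ i) (D'.spin i) (1 - z) (1 - zb)) :=
      opeConvergent_spinning hU hC hs1 hz' hzb'
    exact summable_oriented_of_convergent (s := s) hU' hz hzb h₁ h₂ o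
  · -- scalar labels: half the typed terms
    have h := ((hC z zb hz hzb).summable.subtype
      (fun i => i ∈ ({i : D.ι | D.spin i ≠ 0} : Set D.ι)ᶜ)).mul_left (1 / 2 : ℝ)
    refine h.congr fun i => ?_
    have hi : D.spin i.1 = 0 := by
      by_contra hne
      exact i.2 hne
    simp only [Function.comp_apply]
    rw [hi, crossF_orientedBlock_scalar]
    ring

/-- **The doubling of EVERY unitary typed solution solves the ORIENTED sum rule** (`s < 1`): the two orientations
are summable (`summable_oriented`), add up termwise to the typed family (sum `-F_-[1]`), and assemble over `ι ⊕ ι`.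
This removes the convergence hypothesis of `double_satisfiesCrossing`: splitting a typed pair into its orientations
needs nothing beyond the typed sum rule. [cite: RattazziEtAl2008, §3 eq. (3.6)] -/
theorem double_satisfiesCrossing_of_lt_one (hU : D.IsUnitary) (hC : D.SatisfiesCrossing s) (hs1 : s < 1) :
    D.double.SatisfiesCrossing s := by
  intro z zb hz hzb
  have hT := (summable_oriented hU hC hs1 true hz hzb).hasSum
  have hF := (summable_oriented hU hC hs1 false hz hzb).hasSum
  have hsum : HasSum (fun i => D.p i * crossF s (-1) (globalBlock (D.Δ i) (D.spin i)) z zb)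
      ((∑' i, D.p i * crossF s (-1) (orientedBlock (D.Δ i) (D.spin i) true) z zb) +
        ∑' i, D.p i * crossF s (-1) (orientedBlock (D.Δ i) (D.spin i) false) z zb) := by
    refine (hT.add hF).congr_fun fun i => ?_
    rw [globalBlock_eq_orientedBlock_add (D.Δ i) (D.spin i), crossF_add_apply]
    ring
  have hab := hsum.unique (hC z zb hz hzb)
  have hA : HasSum ((fun j : D.double.ι => D.double.p j *
      crossF s (-1) (orientedBlock (D.double.Δ j) (D.double.spin j) (D.double.orient j)) z zb) ∘ Sum.inl)
      (∑' i, D.p i * crossF s (-1) (orientedBlock (D.Δ i) (D.spin i) true) z zb) :=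
    hT.congr_fun fun _ => rfl
  have hB : HasSum ((fun j : D.double.ι => D.double.p j *
      crossF s (-1) (orientedBlock (D.double.Δ j) (D.double.spin j) (D.double.orient j)) z zb) ∘ Sum.inr)
      (∑' i, D.p i * crossF s (-1) (orientedBlock (D.Δ i) (D.spin i) false) z zb) :=
    hF.congr_fun fun _ => rfl
  have hAB := HasSum.sum hA hB
  rw [hab] at hAB
  exact hAB

/-! ### The oriented totals of the doubling, unconditionally -/

/-- A family on `ι ⊕ ι` that repeats `f` on both copies has unconditional sum `2 Σ' f` — by `HasSum.sum` when `f` is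
summable, and `0 = 2 · 0` otherwise (the repeated family restricted to `Sum.inl` is `f`). [folklore] -/
theorem tsum_sum_elim_self {ι : Type} (f : ι → ℝ) : ∑' j : ι ⊕ ι, Sum.elim f f j = 2 * ∑' i, f i := by
  by_cases hf : Summable f
  · have A : HasSum ((Sum.elim f f) ∘ Sum.inl) (∑' i, f i) := hf.hasSum.congr_fun fun _ => rfl
    have B : HasSum ((Sum.elim f f) ∘ Sum.inr) (∑' i, f i) := hf.hasSum.congr_fun fun _ => rfl
    rw [(HasSum.sum A B).tsum_eq]; ring
  · have hg : ¬ Summable (Sum.elim f f) := fun hg =>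
      hf ((hg.comp_injective Sum.inl_injective).congr fun _ => rfl)
    rw [tsum_eq_zero_of_not_summable hf, tsum_eq_zero_of_not_summable hg]; ring

/-- The `(2,2)`-indicator family of the doubling is the typed one repeated on both copies. [folklore] -/
theorem double_stress_indicator_eq :
    D.double.toCrossingData.stressSet.indicator D.double.p = Sum.elim (D.stressSet.indicator D.p)
      (D.stressSet.indicator D.p) := by
  funext j
  rcases j with i | i
  · exact (double_stress_indicator i).1
  · exact (double_stress_indicator i).2

/-- **The oriented total `(2,2)` coefficient of the doubling is twice the typed one — unconditionally.** [folklore] -/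
theorem double_stressCoeff_eq : D.double.toCrossingData.stressCoeff = 2 * D.stressCoeff := by
  show (∑' j : D.ι ⊕ D.ι, D.double.toCrossingData.stressSet.indicator D.double.p j) =
    2 * ∑' i, D.stressSet.indicator D.p i
  rw [double_stress_indicator_eq]
  exact tsum_sum_elim_self _

/-- The in-box indicator family of the doubling is the typed one repeated on both copies. [folklore] -/
theorem double_box_indicator_eq (e₁ e₂ : ℝ) :
    (D.double.toCrossingData.boxSet e₁ e₂).indicator D.double.p = Sum.elim ((D.boxSet e₁ e₂).indicator D.p)
      ((D.boxSet e₁ e₂).indicator D.p) := by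
  funext j
  rcases j with i | i
  · exact (double_box_indicator e₁ e₂ i).1
  · exact (double_box_indicator e₁ e₂ i).2

/-- **The oriented in-box total of the doubling is twice the typed `p_box` (= `λ²_{σσ[box]}`) — unconditionally.**
[folklore] -/
theorem double_boxCoeff_eq (e₁ e₂ : ℝ) : D.double.toCrossingData.boxCoeff e₁ e₂ = 2 * D.boxCoeff e₁ e₂ := by
  show (∑' j : D.ι ⊕ D.ι, (D.double.toCrossingData.boxSet e₁ e₂).indicator D.double.p j) =
    2 * ∑' i, (D.boxSet e₁ e₂).indicator D.p i
  rw [double_box_indicator_eq]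
  exact tsum_sum_elim_self _

/-- The scalar-gap clause of the doubling is that of `D`. [folklore] -/
theorem double_hasScalarGap {U : ℝ} (h : D.HasScalarGap U) : D.double.toCrossingData.HasScalarGap U := by
  rintro (i | i) hi <;> exact h i hi

end CrossingData

/-! ### The transfer is an equivalence of statement classes (`s < 1`) -/

/-- **`GapExcluded` ⇔ its oriented version** (`s < 1`): no unitary typed solution with scalar gap `U` iff no
unitary ORIENTED solution with scalar gap `U`. (`→`: `GapExcluded.oriented`; `←`: the doubling of a typed
counterexample is an oriented one.) [cite: RattazziEtAl2008, §5] -/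
theorem gapExcluded_iff_oriented {s U : ℝ} (hs1 : s < 1) :
    GapExcluded s U ↔
      ∀ D : OrientedData, D.IsUnitary → D.SatisfiesCrossing s → ¬ D.toCrossingData.HasScalarGap U :=
  ⟨fun h D hU hC => h.oriented D hU hC, fun h D hU hC hgap =>
    h D.double (CrossingData.double_isUnitary hU) (CrossingData.double_satisfiesCrossing_of_lt_one hU hC hs1)
      (CrossingData.double_hasScalarGap hgap)⟩

/-- **`ExcludedAt` ⇔ its oriented version** (`s < 1`). [cite: RattazziEtAl2008, §5] -/
theorem excludedAt_iff_oriented {s G δ x : ℝ} (hs1 : s < 1) :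
    ExcludedAt s G δ x ↔
      ∀ D : OrientedData, D.IsUnitary → D.SatisfiesCrossing s → D.toCrossingData.ScalarsIn ({x} ∪ Ici G) →
        D.toCrossingData.SpinTwoIn ({2} ∪ Ici (2 + δ)) → False :=
  ⟨fun h D hU hC hS hT => h.oriented D hU hC hS hT, fun h D hU hC hS hT => by
    obtain ⟨hS', hT'⟩ := CrossingData.double_clauses hS hT
    exact h D.double (CrossingData.double_isUnitary hU)
      (CrossingData.double_satisfiesCrossing_of_lt_one hU hC hs1) hS' hT'⟩

/-- **`BoxExcluded` ⇔ its oriented version** (`s < 1`). [cite: RattazziEtAl2008, §5] -/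
theorem boxExcluded_iff_oriented {s G δ e₁ e₂ : ℝ} (hs1 : s < 1) :
    BoxExcluded s G δ e₁ e₂ ↔
      ∀ D : OrientedData, D.IsUnitary → D.SatisfiesCrossing s →
        D.toCrossingData.ScalarsIn (Icc e₁ e₂ ∪ Ici G) → D.toCrossingData.SpinTwoIn ({2} ∪ Ici (2 + δ)) → False :=
  ⟨fun h D hU hC hS hT => h.oriented D hU hC hS hT, fun h D hU hC hS hT => by
    obtain ⟨hS', hT'⟩ := CrossingData.double_clauses hS hT
    exact h D.double (CrossingData.double_isUnitary hU)
      (CrossingData.double_satisfiesCrossing_of_lt_one hU hC hs1) hS' hT'⟩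

/-- **The class-1 item `TwoSided` ⇔ its oriented version** (`s < 1`). [cite: RattazziEtAl2008, §5] -/
theorem twoSided_iff_oriented {s G δ w εlo U : ℝ} (hs1 : s < 1) :
    TwoSided s G δ w εlo U ↔
      ∀ D : OrientedData, D.IsUnitary → D.SatisfiesCrossing s →
        D.toCrossingData.SpinTwoIn ({2} ∪ Ici (2 + δ)) → ∀ x : ℝ, w ≤ x →
          D.toCrossingData.ScalarsIn ({x} ∪ Ici G) → εlo < x ∧ x < U :=
  ⟨fun h D hU hC hT x hwx hS => h.oriented D hU hC hT x hwx hS, fun h D hU hC hT x hwx hS => by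
    obtain ⟨hS', hT'⟩ := CrossingData.double_clauses hS hT
    exact h D.double (CrossingData.double_isUnitary hU)
      (CrossingData.double_satisfiesCrossing_of_lt_one hU hC hs1) hT' x hwx hS'⟩

/-- **`CTwoSided` ⇔ its oriented version** (`s < 1`). Oriented reading: a `T` and a `T̄` label with the Ward values
`p_T = s²/(2c_L)`, `p_T̄ = s²/(2c_R)` make the ORIENTED `(2,2)` total `s²/(2c_L) + s²/(2c_R)`, and the conclusion
is for the harmonic mean `2c_Lc_R/(c_L+c_R)`; for the doubling of a typed datum with `p_T = s²/(2c)` one takes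
`c_L = c_R = c` (`double_stressCoeff_eq`), whose harmonic mean is `c`. [cite: BelavinPolyakovZamolodchikov1984, §3] -/
theorem cTwoSided_iff_oriented {s G δ e₁ e₂ clo chi : ℝ} (hs1 : s < 1) :
    CTwoSided s G δ e₁ e₂ clo chi ↔
      ∀ D : OrientedData, D.IsUnitary → D.SatisfiesCrossing s →
        D.toCrossingData.ScalarsIn (Icc e₁ e₂ ∪ Ici G) → D.toCrossingData.SpinTwoIn ({2} ∪ Ici (2 + δ)) →
          ∀ cL cR : ℝ, 0 < cL → 0 < cR →
            D.toCrossingData.stressCoeff = s ^ 2 / (2 * cL) + s ^ 2 / (2 * cR) →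
              clo < 2 * cL * cR / (cL + cR) ∧ 2 * cL * cR / (cL + cR) < chi := by
  refine ⟨fun h D hU hC hS hT cL cR hL hR hW => h.oriented D hU hC hS hT hL hR hW,
    fun h D hU hC hS hT c hc hW => ?_⟩
  obtain ⟨hS', hT'⟩ := CrossingData.double_clauses hS hT
  have hW' : D.double.toCrossingData.stressCoeff = s ^ 2 / (2 * c) + s ^ 2 / (2 * c) := by
    rw [CrossingData.double_stressCoeff_eq, hW]; ring
  have hm : 2 * c * c / (c + c) = c := by field_simp; ring
  have := h D.double (CrossingData.double_isUnitary hU) (CrossingData.double_satisfiesCrossing_of_lt_one hU hC hs1)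
    hS' hT' c c hc hc hW'
  rwa [hm] at this

/-- **`PBoxTwoSided` ⇔ its oriented version** (`s < 1`): the ORIENTED in-box total (`= λ²_{σσ[box]}`) lies in
`(2 lo, 2 hi)` for every oriented datum iff the typed `p_box` lies in `(lo, hi)` for every typed datum
(`double_boxCoeff_eq`). [cite: RattazziEtAl2008, §5] -/
theorem pBoxTwoSided_iff_oriented {s G δ e₁ e₂ lo hi : ℝ} (hs1 : s < 1) :
    PBoxTwoSided s G δ e₁ e₂ lo hi ↔
      ∀ D : OrientedData, D.IsUnitary → D.SatisfiesCrossing s →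
        D.toCrossingData.ScalarsIn (Icc e₁ e₂ ∪ Ici G) → D.toCrossingData.SpinTwoIn ({2} ∪ Ici (2 + δ)) →
          2 * lo < D.toCrossingData.boxCoeff e₁ e₂ ∧ D.toCrossingData.boxCoeff e₁ e₂ < 2 * hi := by
  refine ⟨fun h D hU hC hS hT => h.oriented D hU hC hS hT, fun h D hU hC hS hT => ?_⟩
  obtain ⟨hS', hT'⟩ := CrossingData.double_clauses hS hT
  have h2 := h D.double (CrossingData.double_isUnitary hU) (CrossingData.double_satisfiesCrossing_of_lt_one hU hC hs1)
    hS' hT'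
  rw [CrossingData.double_boxCoeff_eq] at h2
  constructor <;> linarith [h2.1, h2.2]

/-- **The three-datum data set ⇔ its oriented version** (`s < 1`): `ControlDataSet` (location window, Ward `c`
interval, `p_box` interval) holds for all typed `A2D′` data iff the oriented reading (location window, harmonic-mean
`c` interval under the oriented Ward hypothesis, oriented in-box total in `(2 p_lo, 2 p_hi)`) holds for all
parity-unconstrained data. [cite: RattazziEtAl2008, §5] -/
theorem controlDataSet_iff_oriented {s G δ w εlo εhi clo chi plo phi : ℝ} (hs1 : s < 1) :
    ControlDataSet s G δ w εlo εhi clo chi plo phi ↔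
      ∀ D : OrientedData, D.IsUnitary → D.SatisfiesCrossing s →
        D.toCrossingData.SpinTwoIn ({2} ∪ Ici (2 + δ)) → ∀ x : ℝ, w ≤ x →
          D.toCrossingData.ScalarsIn ({x} ∪ Ici G) →
            (εlo < x ∧ x < εhi) ∧
              (∀ cL cR : ℝ, 0 < cL → 0 < cR →
                D.toCrossingData.stressCoeff = s ^ 2 / (2 * cL) + s ^ 2 / (2 * cR) →
                  clo < 2 * cL * cR / (cL + cR) ∧ 2 * cL * cR / (cL + cR) < chi) ∧
              (2 * plo < D.toCrossingData.boxCoeff εlo εhi ∧ D.toCrossingData.boxCoeff εlo εhi < 2 * phi) := by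
  refine ⟨fun h D hU hC hT x hwx hS => h.oriented D hU hC hT x hwx hS, fun h D hU hC hT x hwx hS => ?_⟩
  obtain ⟨hS', hT'⟩ := CrossingData.double_clauses hS hT
  obtain ⟨hx, hc, hp⟩ := h D.double (CrossingData.double_isUnitary hU)
    (CrossingData.double_satisfiesCrossing_of_lt_one hU hC hs1) hT' x hwx hS'
  refine ⟨hx, fun c hc0 hW => ?_, ?_⟩
  · have hW' : D.double.toCrossingData.stressCoeff = s ^ 2 / (2 * c) + s ^ 2 / (2 * c) := by
      rw [CrossingData.double_stressCoeff_eq, hW]; ring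
    have hm : 2 * c * c / (c + c) = c := by field_simp; ring
    have := hc c c hc0 hc0 hW'
    rwa [hm] at this
  · rw [CrossingData.double_boxCoeff_eq] at hp
    constructor <;> linarith [hp.1, hp.2]

/-! ### The record's class consists of convergent, crossing-symmetric four-point functions (`Δ_σ = 1/8`) -/

/-- **Every typed `A2D′` datum of the record's class is a convergent crossing-symmetric four-point function on the
open square.** At `Δ_σ = 1/8`, for every window `w`: a unitary solution with spin 2 in `{2} ∪ [3,∞)` and scalars in
`{x} ∪ [2,∞)`, `w ≤ x`, has `x > 99/100` by the record (`twoSided_2d_kernel099`), hence all labels above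
`2Δ_σ = 1/4`, hence (part 1) `Σ p_i g_i(z,z̄)` converges absolutely at every point of `(0,1)²` and
`v^{1/8} G(z,z̄) = u^{1/8} G(1-z,1-z̄)` there, `G = 1 + Σ p g`. CONTROL-ONLY. [cite: RattazziEtAl2008, §3 eq. (3.3)] -/
theorem record_fourPoint_crossing (w : ℝ) (D : CrossingData) (hU : D.IsUnitary)
    (hC : D.SatisfiesCrossing (1 / 8)) (hT : D.SpinTwoIn ({2} ∪ Ici (2 + 1))) (x : ℝ) (hwx : w ≤ x)
    (hS : D.ScalarsIn ({x} ∪ Ici 2)) :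
    D.OpeConvergent ∧ ∀ z zb : ℝ, z ∈ Ioo (0 : ℝ) 1 → zb ∈ Ioo (0 : ℝ) 1 →
      ((1 - z) * (1 - zb)) ^ (1 / 8 : ℝ) * D.fourPoint z zb =
        (z * zb) ^ (1 / 8 : ℝ) * D.fourPoint (1 - z) (1 - zb) := by
  have hx : (99 / 100 : ℝ) < x := ((twoSided_2d_kernel099 w) D hU hC hT x hwx hS).1
  have hconv : D.OpeConvergent :=
    CrossingData.opeConvergent_of_location hU hC hS (by linarith) (by norm_num) (by norm_num)
  exact ⟨hconv, fun _ _ hz hzb => CrossingData.fourPoint_crossing hC hconv hz hzb⟩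

/-- The generalised-free-field witness of E.1c is OPE-convergent on the open square (its block expansion was summed
in closed form in `Control2DNonVacuity`). [folklore] -/
theorem gffData2D_opeConvergent {s : ℝ} (hs : 0 < s) : (gffData2D s).OpeConvergent :=
  fun _ _ hz hzb => (hasSum_gffData2D_blocks hs hz hzb).summable

/-- The 2D Ising datum of E.1e is OPE-convergent on the open square (`hasSum_isingData2D_blocks`).
[cite: BelavinPolyakovZamolodchikov1984, App. E] -/
theorem isingData2D_opeConvergent : isingData2D.OpeConvergent :=
  fun _ _ hz hzb => (hasSum_isingData2D_blocks hz hzb).summable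

end Summit.CriticalPhenomena.Ising3D.Control2D
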